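import Literature.MathematicalPhysics.KineticTheory.FreeTransportDuhamel
import Literature.Analysis.FunctionSpaces.SmoothParametricIntegral
import HarnessLib

/-!
# Uniqueness of distributional solutions of the free transport equation vanishing for early times

Topic: MathematicalPhysics / KineticTheory. Sequel of `FreeTransportDuhamel`, infrastructure for
the `L¹` velocity-averaging lemma (CIP 1994 Lemma 5.3.9): the statement used on p. 155 of
Cercignani–Illner–Pulvirenti 1994 ("`gₙ` is the unique solution of `T f = T gₙ`, `f|_{t=0} = 0`")
in the form needed there — a locally integrable `w` with `(∂ₜ + ξ·∇ₓ) w = 0` in `𝒟'(ℝ × E × E)`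
which vanishes for times `≤ a` vanishes almost everywhere — and its corollary that a
distributional solution of `T f = F` vanishing for early times *is* the Duhamel integral
`sourceDuhamel F` (`FreeTransportDuhamel`). Everything is proved; the argument is the classical
duality (Perthame, *Transport Equations in Biology* (2007), §6.1.1, proof of Thm. 6.2,
"Uniqueness": solve the backward dual problem with a smooth compactly supported datum and test
the equation against it): for a test function `η` the **dual Duhamel integral**
`Φ(z) = ∫₀^S η(shear_{-σ} z) dσ` is smooth, compactly supported, and `TΦ = η ∘ shear_{-S} - η`;
testing `Tw = 0` against `Φ` gives `∫ w η = ∫ w · (η ∘ shear_{-S}) = 0` for `S` large, whence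
`w = 0` a.e. (`ae_eq_zero_of_integral_contDiff_smul_eq_zero`).

* `dualDuhamel η S`, `contDiff_dualDuhamel`, `hasCompactSupport_dualDuhamel`,
  `transportDeriv_dualDuhamel`.
* `ae_eq_zero_of_hasDistribTransportOn_zero` (uniqueness),
  `ae_eq_sourceDuhamel_of_hasDistribTransportOn` (representation `f = sourceDuhamel F` a.e.).

## References

* C. Cercignani, R. Illner, M. Pulvirenti, *The Mathematical Theory of Dilute Gases*, Springer
  (1994), §5.3, proof of Lemma 5.3.9, p. 155. [CIP1994]
* B. Perthame, *Transport Equations in Biology*, Birkhäuser (2007), §6.1.1, Thm. 6.2 (weak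
  solutions; uniqueness by duality).
-/

noncomputable section

open MeasureTheory Set Filter Function intervalIntegral Metric
open _root_.Topology
open scoped ENNReal NNReal ContDiff

namespace Literature.MathematicalPhysics.KineticTheory

/-! ## The dual Duhamel integral of a test function -/

section Dual

variable {E : Type*} [NormedAddCommGroup E] [NormedSpace ℝ E]

/-- The **dual (forward) Duhamel integral** of a test function over lags in `(0, S)`:
`dualDuhamel η S z = ∫₀^S η(shear_{-σ} z) dσ = ∫₀^S η(t + σ, x + σξ, ξ) dσ`, the solution of the
backward problem `TΦ = η ∘ shear_{-S} - η` used in the duality argument (Perthame 2007, §6.1.1,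
proof of Thm. 6.2). [folklore] -/
def dualDuhamel (η : ℝ × E × E → ℝ) (S : ℝ) (z : ℝ × E × E) : ℝ :=
  ∫ σ in (0 : ℝ)..S, η (shear (-σ) z)

/-- Unfolding of `dualDuhamel`. [folklore] -/
theorem dualDuhamel_apply (η : ℝ × E × E → ℝ) (S : ℝ) (z : ℝ × E × E) :
    dualDuhamel η S z = ∫ σ in (0 : ℝ)..S, η (shear (-σ) z) := rfl

/-- The forward shear `(σ, z) ↦ shear (-σ) z` is smooth. [folklore] -/
theorem contDiff_shear_neg_uncurry :
    ContDiff ℝ ∞ fun q : ℝ × (ℝ × E × E) => shear (-q.1) q.2 := by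
  have h : (fun q : ℝ × (ℝ × E × E) => shear (-q.1) q.2) =
      fun q => (q.2.1 + q.1, q.2.2.1 + q.1 • q.2.2.2, q.2.2.2) := by
    funext q
    simp [shear, sub_neg_eq_add, neg_smul]
  rw [h]
  fun_prop

variable [FiniteDimensional ℝ E]

/-- The dual Duhamel integral of a smooth function is smooth (differentiation under the
integral sign, `Literature.Analysis.FunctionSpaces.contDiff_parametric_intervalIntegral_comp`). [folklore] -/
theorem contDiff_dualDuhamel {η : ℝ × E × E → ℝ} (hη : ContDiff ℝ ∞ η) (S : ℝ) :
    ContDiff ℝ ∞ (dualDuhamel η S) :=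
  Literature.Analysis.FunctionSpaces.contDiff_parametric_intervalIntegral_comp hη
    contDiff_shear_neg_uncurry 0 S

omit [FiniteDimensional ℝ E] in
/-- A point one of whose forward shears (with lag in `[0, S]`, `0 ≤ S`) lies in the ball of
radius `ρ` lies in the ball of radius `ρ + S + S ρ` (sup norm on `ℝ × E × E`). [folklore] -/
theorem norm_le_of_shear_neg_mem_closedBall {z : ℝ × E × E} {σ S ρ : ℝ} (hσ0 : 0 ≤ σ)
    (hσS : σ ≤ S) (hρ : 0 ≤ ρ) (h : shear (-σ) z ∈ closedBall (0 : ℝ × E × E) ρ) :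
    ‖z‖ ≤ ρ + S + S * ρ := by
  rw [mem_closedBall_zero_iff] at h
  have h1 : ‖(shear (-σ) z).1‖ ≤ ρ := (norm_fst_le _).trans h
  have h2 : ‖(shear (-σ) z).2.1‖ ≤ ρ := (norm_fst_le _).trans ((norm_snd_le _).trans h)
  have h3 : ‖(shear (-σ) z).2.2‖ ≤ ρ := (norm_snd_le _).trans ((norm_snd_le _).trans h)
  simp only [shear, sub_neg_eq_add, neg_smul] at h1 h2 h3
  have hξ : ‖z.2.2‖ ≤ ρ := h3
  have ht : ‖z.1‖ ≤ ρ + S := by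
    have : ‖z.1‖ ≤ ‖z.1 + σ‖ + ‖σ‖ := by
      calc ‖z.1‖ = ‖(z.1 + σ) - σ‖ := by rw [add_sub_cancel_right]
        _ ≤ ‖z.1 + σ‖ + ‖σ‖ := norm_sub_le _ _
    rw [Real.norm_of_nonneg hσ0] at this
    linarith
  have hx : ‖z.2.1‖ ≤ ρ + S * ρ := by
    have : ‖z.2.1‖ ≤ ‖z.2.1 + σ • z.2.2‖ + ‖σ • z.2.2‖ := by
      calc ‖z.2.1‖ = ‖(z.2.1 + σ • z.2.2) - σ • z.2.2‖ := by rw [add_sub_cancel_right]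
        _ ≤ _ := norm_sub_le _ _
    rw [norm_smul, Real.norm_of_nonneg hσ0] at this
    nlinarith [norm_nonneg z.2.2]
  have hS : 0 ≤ S := hσ0.trans hσS
  calc ‖z‖ = max ‖z.1‖ (max ‖z.2.1‖ ‖z.2.2‖) := by rw [Prod.norm_def, Prod.norm_def]
    _ ≤ ρ + S + S * ρ := by
        refine max_le (by nlinarith) (max_le (by nlinarith) ?_)
        nlinarith

omit [FiniteDimensional ℝ E] in
/-- If `η` vanishes off the ball of radius `ρ`, then `dualDuhamel η S` (`0 ≤ S`) vanishes off the
ball of radius `ρ + S + S ρ`. [folklore] -/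
theorem dualDuhamel_eq_zero_of_norm_gt {η : ℝ × E × E → ℝ} {ρ : ℝ} (hρ : 0 ≤ ρ)
    (hη : ∀ z, z ∉ closedBall (0 : ℝ × E × E) ρ → η z = 0) {S : ℝ} (hS : 0 ≤ S) {z : ℝ × E × E}
    (hz : ρ + S + S * ρ < ‖z‖) : dualDuhamel η S z = 0 := by
  rw [dualDuhamel_apply]
  refine intervalIntegral.integral_zero_ae (ae_of_all _ fun σ hσ => hη _ fun h => ?_)
  rw [uIoc_of_le hS] at hσ
  exact (norm_le_of_shear_neg_mem_closedBall hσ.1.le hσ.2 hρ h).not_gt hz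

/-- The dual Duhamel integral of a compactly supported function (`0 ≤ S`) has compact
support. [folklore] -/
theorem hasCompactSupport_dualDuhamel {η : ℝ × E × E → ℝ} (hηc : HasCompactSupport η) {S : ℝ}
    (hS : 0 ≤ S) : HasCompactSupport (dualDuhamel η S) := by
  obtain ⟨ρ, hρ⟩ := hηc.isCompact.isBounded.subset_closedBall (0 : ℝ × E × E)
  set ρ' : ℝ := max ρ 0 with hρ'
  have hη : ∀ z, z ∉ closedBall (0 : ℝ × E × E) ρ' → η z = 0 := fun z hz =>
    image_eq_zero_of_notMem_tsupport fun h => hz (closedBall_subset_closedBall (le_max_left _ _)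
      (hρ h))
  refine HasCompactSupport.of_support_subset_isCompact (isCompact_closedBall (0 : ℝ × E × E)
    (ρ' + S + S * ρ')) fun z hz => ?_
  rw [mem_closedBall_zero_iff]
  by_contra h
  exact hz (dualDuhamel_eq_zero_of_norm_gt (le_max_right _ _) hη hS (not_le.1 h))

omit [FiniteDimensional ℝ E] in
/-- Along the forward characteristic the dual Duhamel integral is a moving-window integral:
`dualDuhamel η S (shear_{-τ} z) = ∫_τ^{τ+S} η(shear_{-u} z) du`. [folklore] -/
theorem dualDuhamel_shear_neg (η : ℝ × E × E → ℝ) (S τ : ℝ) (z : ℝ × E × E) :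
    dualDuhamel η S (shear (-τ) z) = ∫ u in τ..τ + S, η (shear (-u) z) := by
  rw [dualDuhamel_apply]
  have h : (fun σ => η (shear (-σ) (shear (-τ) z))) = fun σ => η (shear (-(σ + τ)) z) := by
    funext σ
    rw [shear_shear, neg_add]
  rw [h, intervalIntegral.integral_comp_add_right (fun u => η (shear (-u) z)) τ, zero_add,
    add_comm]

end Dual

/-! ## Uniqueness and the Duhamel representation -/

section Unique

variable {E : Type*} [NormedAddCommGroup E] [InnerProductSpace ℝ E] [FiniteDimensional ℝ E]
  [MeasurableSpace E] [BorelSpace E]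

omit [FiniteDimensional ℝ E] [MeasurableSpace E] [BorelSpace E] in
/-- **The dual Duhamel integral solves the backward problem**: for continuous `η` and
differentiable `Φ = dualDuhamel η S`, `TΦ(z) = η(shear_{-S} z) - η(z)` (differentiate the
moving-window integral `∫_τ^{τ+S} η(shear_{-u} z) du` at `τ = 0`). [folklore] -/
theorem transportDeriv_dualDuhamel {η : ℝ × E × E → ℝ} (hηc : Continuous η) {S : ℝ}
    (hd : Differentiable ℝ (dualDuhamel η S)) (z : ℝ × E × E) :
    transportDeriv (dualDuhamel η S) z = η (shear (-S) z) - η z := by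
  -- derivative along the characteristic through `z`, computed in two ways at `τ = 0`
  have h1 : HasDerivAt (fun τ : ℝ => dualDuhamel η S (shear (-τ) z))
      (transportDeriv (dualDuhamel η S) (shear (-(0 : ℝ)) z)) 0 :=
    hasDerivAt_comp_shear_neg hd z 0
  rw [neg_zero, shear_zero] at h1
  have hg : Continuous fun u : ℝ => η (shear (-u) z) :=
    hηc.comp (continuous_shear_uncurry.comp (continuous_neg.prodMk continuous_const))
  have h2 : HasDerivAt (fun τ : ℝ => dualDuhamel η S (shear (-τ) z))
      (η (shear (-(0 + S)) z) - η (shear (-(0 : ℝ)) z)) 0 := by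
    have hfun : (fun τ : ℝ => dualDuhamel η S (shear (-τ) z)) =
        fun τ => (∫ u in (0 : ℝ)..τ + S, η (shear (-u) z)) - ∫ u in (0 : ℝ)..τ, η (shear (-u) z) := by
      funext τ
      rw [dualDuhamel_shear_neg, eq_sub_iff_add_eq, add_comm,
        intervalIntegral.integral_add_adjacent_intervals (hg.intervalIntegrable _ _)
          (hg.intervalIntegrable _ _)]
    rw [hfun]
    refine HasDerivAt.sub ?_ (hg.integral_hasStrictDerivAt 0 0).hasDerivAt
    exact HasDerivAt.comp_add_const 0 S (hg.integral_hasStrictDerivAt 0 (0 + S)).hasDerivAt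
  have h := h1.unique h2
  simpa using h

/-- **Uniqueness for the free transport equation in `𝒟'` with vanishing past.** A locally
integrable `w` on `ℝ × E × E` with `(∂ₜ + ξ·∇ₓ) w = 0` in `𝒟'(ℝ × E × E)` which vanishes a.e. for
times `≤ a` vanishes a.e. Proof by duality (Perthame 2007, §6.1.1, proof of Thm. 6.2; the
statement used in CIP 1994, p. 155): test the equation against the dual Duhamel integral `Φ` of
an arbitrary test function `η` (`TΦ = η ∘ shear_{-S} - η`), so that
`∫ w η = ∫ w · (η ∘ shear_{-S}) = 0` once `S` exceeds the time-width of the supports; then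
`w = 0` a.e. by `ae_eq_zero_of_integral_contDiff_smul_eq_zero`. [cite: CIP1994, §5.3 proof of Lemma 5.3.9, p. 155] -/
theorem ae_eq_zero_of_hasDistribTransportOn_zero {w : ℝ × E × E → ℝ}
    (hw : LocallyIntegrable w volume) {a : ℝ} (hwa : ∀ᵐ z ∂volume, z.1 ≤ a → w z = 0)
    (hT : HasDistribTransportOn univ w fun _ => 0) : w =ᵐ[volume] 0 := by
  refine ae_eq_zero_of_integral_contDiff_smul_eq_zero hw fun η hη hηc => ?_
  -- supports: `η` lives in the ball of radius `ρ`
  obtain ⟨ρ₀, hρ₀⟩ := hηc.isCompact.isBounded.subset_closedBall (0 : ℝ × E × E)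
  set ρ : ℝ := max ρ₀ 0 with hρ_def
  have hρ0 : 0 ≤ ρ := le_max_right _ _
  have hηρ : ∀ z, z ∉ closedBall (0 : ℝ × E × E) ρ → η z = 0 := fun z hz =>
    image_eq_zero_of_notMem_tsupport fun h => hz (closedBall_subset_closedBall (le_max_left _ _)
      (hρ₀ h))
  have hηt : ∀ z, η z ≠ 0 → |z.1| ≤ ρ := fun z hz => by
    have h : z ∈ closedBall (0 : ℝ × E × E) ρ := by_contra fun h => hz (hηρ z h)
    exact (Real.norm_eq_abs _ ▸ norm_fst_le z).trans (mem_closedBall_zero_iff.1 h)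
  -- the lag
  set S : ℝ := ρ + |a| + ρ + 1 with hS_def
  have hS0 : 0 ≤ S := by positivity
  -- the dual test function
  set Φ : ℝ × E × E → ℝ := dualDuhamel η S with hΦ_def
  have hΦs : ContDiff ℝ ∞ Φ := contDiff_dualDuhamel hη S
  have hΦc : HasCompactSupport Φ := hasCompactSupport_dualDuhamel hηc hS0
  have hTΦ : ∀ z, transportDeriv Φ z = η (shear (-S) z) - η z := fun z =>
    transportDeriv_dualDuhamel hη.continuous (hΦs.differentiable (by simp)) z
  -- test the equation
  have h1 := hT.2.2 Φ hΦs hΦc (by simp)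
  simp only [zero_mul, integral_zero, neg_zero] at h1
  -- `∫ w · (η ∘ shear_{-S}) = 0`: the integrand vanishes a.e.
  have hηS : Continuous fun z : ℝ × E × E => η (shear (-S) z) :=
    hη.continuous.comp (continuous_shear (-S))
  have hηSc : HasCompactSupport fun z : ℝ × E × E => η (shear (-S) z) := by
    refine HasCompactSupport.of_support_subset_isCompact
      (isCompact_closedBall (0 : ℝ × E × E) (ρ + S + S * ρ)) fun z hz => ?_
    rw [mem_closedBall_zero_iff]
    exact norm_le_of_shear_neg_mem_closedBall hS0 le_rfl hρ0
      (by_contra fun h => hz (hηρ _ h))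
  have h2 : ∫ z, w z * η (shear (-S) z) = 0 := by
    refine integral_eq_zero_of_ae ?_
    filter_upwards [hwa] with z hz
    show w z * η (shear (-S) z) = 0
    by_cases hza : z.1 ≤ a
    · rw [hz hza, zero_mul]
    · have hη0 : η (shear (-S) z) = 0 := by
        by_contra h
        have h3 := hηt _ h
        simp only [shear, sub_neg_eq_add] at h3
        have h4 := (abs_le.1 h3).2
        have h5 : -|a| ≤ a := neg_abs_le a
        push Not at hza
        linarith
      rw [hη0, mul_zero]
  -- integrability of the two pieces of `w · TΦ`
  have hi1 : Integrable (fun z => w z * η (shear (-S) z)) volume := by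
    simpa only [smul_eq_mul, mul_comm (w _)] using
      hw.integrable_smul_left_of_hasCompactSupport hηS hηSc
  have hi2 : Integrable (fun z => w z * η z) volume := by
    simpa only [smul_eq_mul, mul_comm (w _)] using
      hw.integrable_smul_left_of_hasCompactSupport hη.continuous hηc
  have h3 : ∫ z, w z * transportDeriv Φ z = (∫ z, w z * η (shear (-S) z)) - ∫ z, w z * η z := by
    simp_rw [hTΦ, mul_sub]
    exact integral_sub hi1 hi2
  rw [h1, h2, zero_sub, eq_comm, neg_eq_zero] at h3
  simpa only [smul_eq_mul, mul_comm (η _)] using h3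

/-- **The Duhamel representation of distributional solutions with vanishing past** (CIP 1994,
p. 155: "`gₙ` is the unique solution of `T f = T gₙ`, `f|_{t=0} = 0`" together with the
displayed characteristics formula). If `f` is locally integrable, `F` is measurable and
integrable, both vanish for times `≤ a` (`f` almost everywhere), and `(∂ₜ + ξ·∇ₓ) f = F` in
`𝒟'(ℝ × E × E)`, then `f = sourceDuhamel F` almost everywhere. [cite: CIP1994, §5.3 proof of Lemma 5.3.9, p. 155] -/
theorem ae_eq_sourceDuhamel_of_hasDistribTransportOn {f F : ℝ × E × E → ℝ}
    (hf : LocallyIntegrable f volume) (hFm : Measurable F) (hFi : Integrable F volume) {a : ℝ}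
    (hfa : ∀ᵐ z ∂volume, z.1 ≤ a → f z = 0) (hFa : ∀ z, z.1 ≤ a → F z = 0)
    (hT : HasDistribTransportOn univ f F) : f =ᵐ[volume] sourceDuhamel F := by
  have hD := hasDistribTransportOn_sourceDuhamel hFm hFi hFa
  have hDl : LocallyIntegrable (sourceDuhamel F) volume := locallyIntegrable_sourceDuhamel hFm hFi hFa
  set w : ℝ × E × E → ℝ := fun z => f z - sourceDuhamel F z with hw_def
  have hw : LocallyIntegrable w volume := hf.sub hDl
  have hwa : ∀ᵐ z ∂volume, z.1 ≤ a → w z = 0 := by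
    filter_upwards [hfa] with z hz hza
    rw [hw_def]
    simp only [hz hza, sourceDuhamel_eq_zero_of_le hFa z hza, sub_zero]
  have hTw : HasDistribTransportOn univ w fun _ => 0 := by
    refine ⟨?_, locallyIntegrableOn_zero, fun φ hφ hφc _ => ?_⟩
    · rw [univ_prod_univ, locallyIntegrableOn_univ]; exact hw
    have hTc : Continuous (transportDeriv φ) := by
      unfold transportDeriv
      exact (hφ.continuous_fderiv (by simp)).clm_apply (by fun_prop)
    have hTcs : HasCompactSupport (transportDeriv φ) := hasCompactSupport_transportDeriv hφc
    have hi1 : Integrable (fun z => f z * transportDeriv φ z) volume := by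
      simpa only [smul_eq_mul, mul_comm (f _)] using
        hf.integrable_smul_left_of_hasCompactSupport hTc hTcs
    have hi2 : Integrable (fun z => sourceDuhamel F z * transportDeriv φ z) volume := by
      simpa only [smul_eq_mul, mul_comm (sourceDuhamel F _)] using
        hDl.integrable_smul_left_of_hasCompactSupport hTc hTcs
    have e1 := hT.2.2 φ hφ hφc (by simp)
    have e2 := hD.2.2 φ hφ hφc (by simp)
    simp only [hw_def, sub_mul, integral_sub hi1 hi2, e1, e2, sub_self, zero_mul, integral_zero,
      neg_zero]
  have h := ae_eq_zero_of_hasDistribTransportOn_zero hw hwa hTw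
  filter_upwards [h] with z hz
  simpa [hw_def, sub_eq_zero] using hz

end Unique

end Literature.MathematicalPhysics.KineticTheory
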